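import Summits.AnomalousDissipation.AnomalousDissipation.Theorems.MomentParityPathField
import Summits.AnomalousDissipation.AnomalousDissipation.Theorems.MomentParityLevelNOrbit
import Summits.AnomalousDissipation.AnomalousDissipation.Theorems.MomentParityFamilyOfOrbits
import Literature.Analysis.FluidPDE.NSGalerkinFamilyWeakForm

/-!
# Route MomentParity · `GalerkinEnsembleRealization` — the energy/dissipation coupling along
  limits of Galerkin orbits

For a path `ω ∈ 𝒦 = pathSpace R (pathLip ν A R)` which is the pointwise limit (at every time
`t ≥ 0` and frequency `k`) of the orbit paths of Galerkin orbits of orders `N j → ∞` confined in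
the energy ball of radius `R`, the Galerkin energy identity passes to the limit and gives, for
every integer window `[0, n]`,
`∫₀ⁿ pathDiss ν K ω ≤ R²/2 + ‖f‖₂ √n (∫₀ⁿ pathEnergyTot ω)^{1/2}`,
i.e. for the Birkhoff averages along the unit shift `θ`
`A_n F_d(ω) ≤ (R²/2)/n + ‖f‖₂ (A_n F_e(ω))^{1/2}` — the coupling hypothesis of the selection lemma
`exists_mem_support_birkhoff_limits` (stmt-AnomalousDissipation-11466).
-/

noncomputable section

set_option linter.dupNamespace false

open MeasureTheory Set Filter Topology Function UnitAddTorus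
open scoped BigOperators ENNReal InnerProductSpace RealInnerProductSpace Interval

namespace Summit.AnomalousDissipation.AnomalousDissipation.Theorems.MomentParity

open Literature.Analysis.FunctionSpaces Literature.Analysis.FunctionSpaces.Torus
open Literature.Analysis.FluidPDE Literature.Analysis.FluidPDE.Torus

/-! ### Cauchy–Schwarz for square roots in time -/

/-- `∫₀ⁿ √g ≤ √n (∫₀ⁿ g)^{1/2}` for a nonnegative `g` (AM–GM with an optimised parameter). -/
theorem integral_sqrt_le {g : ℝ → ℝ} {n : ℝ} (hn : 0 ≤ n) (hg0 : ∀ t, 0 ≤ g t)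
    (hgi : IntervalIntegrable g volume 0 n)
    (hsi : IntervalIntegrable (fun t => Real.sqrt (g t)) volume 0 n) :
    ∫ t in (0 : ℝ)..n, Real.sqrt (g t) ≤ Real.sqrt n * Real.sqrt (∫ t in (0 : ℝ)..n, g t) := by
  obtain ⟨I, hIdef⟩ : ∃ I, I = ∫ t in (0 : ℝ)..n, g t := ⟨_, rfl⟩
  obtain ⟨J, hJdef⟩ : ∃ J, J = ∫ t in (0 : ℝ)..n, Real.sqrt (g t) := ⟨_, rfl⟩
  rw [← hIdef, ← hJdef]
  have hI : 0 ≤ I := hIdef ▸ intervalIntegral.integral_nonneg hn fun t _ => hg0 t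
  have hJ0 : 0 ≤ J := hJdef ▸ intervalIntegral.integral_nonneg hn fun t _ => Real.sqrt_nonneg _
  -- AM–GM: `J ≤ I/(2λ) + nλ/2` for every `λ > 0`
  have hAMGM : ∀ lam : ℝ, 0 < lam → J ≤ I / (2 * lam) + n * lam / 2 := by
    intro lam hlam
    have hpt : ∀ t, Real.sqrt (g t) ≤ g t / (2 * lam) + lam / 2 := by
      intro t
      have h1 : 0 ≤ (Real.sqrt (g t) - lam) ^ 2 := sq_nonneg _
      have h2 : Real.sqrt (g t) ^ 2 = g t := Real.sq_sqrt (hg0 t)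
      rw [div_add_div _ _ (by positivity) two_ne_zero, le_div_iff₀ (by positivity)]
      nlinarith
    rw [hJdef, hIdef]
    calc ∫ t in (0 : ℝ)..n, Real.sqrt (g t) ≤ ∫ t in (0 : ℝ)..n, (g t / (2 * lam) + lam / 2) :=
          intervalIntegral.integral_mono_on hn hsi ((hgi.div_const _).add intervalIntegrable_const)
            fun t _ => hpt t
      _ = (∫ t in (0 : ℝ)..n, g t) / (2 * lam) + n * lam / 2 := by
          rw [intervalIntegral.integral_add (hgi.div_const _) intervalIntegrable_const,
            intervalIntegral.integral_div, intervalIntegral.integral_const, sub_zero, smul_eq_mul]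
          ring
  -- `J² ≤ n I`
  have hsq : J ^ 2 ≤ n * I := by
    rcases hJ0.eq_or_lt with hJ | hJ
    · rw [← hJ, zero_pow two_ne_zero]; exact mul_nonneg hn hI
    have hnpos : 0 < n := by
      rcases hn.eq_or_lt with h0 | h0
      · exfalso
        have : J = 0 := by rw [hJdef, ← h0, intervalIntegral.integral_same]
        exact hJ.ne' this
      · exact h0
    have h := hAMGM (J / n) (div_pos hJ hnpos)
    have key : J * (2 * (J / n)) ≤ I + n * (J / n) * (J / n) := by
      have h2 : (0 : ℝ) ≤ 2 * (J / n) := by positivity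
      calc J * (2 * (J / n)) ≤ (I / (2 * (J / n)) + n * (J / n) / 2) * (2 * (J / n)) :=
            mul_le_mul_of_nonneg_right h h2
        _ = I + n * (J / n) * (J / n) := by
            field_simp
    have e1 : J * (2 * (J / n)) = 2 * (J ^ 2 / n) := by ring
    have e2 : n * (J / n) * (J / n) = J ^ 2 / n := by field_simp
    rw [e1, e2] at key
    have key2 : J ^ 2 / n ≤ I := by linarith
    rwa [div_le_iff₀ hnpos, mul_comm] at key2
  calc J = Real.sqrt (J ^ 2) := (Real.sqrt_sq hJ0).symm
    _ ≤ Real.sqrt (n * I) := Real.sqrt_le_sqrt hsq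
    _ = Real.sqrt n * Real.sqrt I := Real.sqrt_mul hn I

/-! ### Galerkin orbits: energy and enstrophy of the slices -/

variable {ν : ℝ} {f : UnitAddTorus (Fin 3) → EuclideanSpace ℝ (Fin 3)}

/-- The energy of a slice of a Galerkin orbit is the energy of its coefficients. -/
theorem integral_norm_sq_galerkinFlow_realTrigPoly {N : ℕ}
    {c : ↥(freqBall (d := Fin 3) N) → EuclideanSpace ℂ (Fin 3)}
    (hc : c ∈ galerkinSubspace (freqBall N)) (t : ℝ) :
    ∫ x, ‖galerkinFlow ν f N t (realTrigPoly (freqBall N) (coeffExt (freqBall N) c)) x‖ ^ 2 =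
      ∑ k ∈ freqBall N, ‖coeffExt (freqBall N)
        (galerkinCoeffFlow ν (fourierRestrict (freqBall N) f) t c) k‖ ^ 2 := by
  rw [galerkinFlow_realTrigPoly hc]
  exact integral_norm_sq_realTrigPoly_coeffExt (galerkinCoeffFlow_mem hc t)

/-- The enstrophy of a slice of a Galerkin orbit is finite. -/
theorem eGradNormSq_galerkinFlow_realTrigPoly_ne_top {N : ℕ}
    {c : ↥(freqBall (d := Fin 3) N) → EuclideanSpace ℂ (Fin 3)}
    (hc : c ∈ galerkinSubspace (freqBall N)) (t : ℝ) :
    eGradNormSq (galerkinFlow ν f N t (realTrigPoly (freqBall N) (coeffExt (freqBall N) c))) ≠ ⊤ := by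
  rw [galerkinFlow_realTrigPoly hc,
    eGradNormSq_coeffExt neg_mem_freqBall_of_mem (galerkinCoeffFlow_mem hc t).1]
  exact ENNReal.ofReal_ne_top

/-! ### The coupling at a fixed Galerkin level -/

/-- **Galerkin energy inequality for the resolved dissipation of an orbit path**: for the orbit
of `c j` (order `N j`, energy `≤ R²`) and every integer window,
`∫₀ⁿ pathDiss ν K (orbitPath c j) ≤ R²/2 + ∫₀ⁿ ∫ ⟪f, U_j(τ)⟫ dτ`. -/
theorem intervalIntegral_pathDiss_orbit_le (hν : 0 < ν) (hf : IsSmooth f) {R A : ℝ} (Kc : ℕ)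
    {N : ℕ → ℕ} (hN : Tendsto N atTop atTop)
    {c : (j : ℕ) → ↥(freqBall (d := Fin 3) (N j)) → EuclideanSpace ℂ (Fin 3)}
    (hc : ∀ j, c j ∈ galerkinSubspace (freqBall (N j)))
    (hconf : ∀ j t, 0 ≤ t → ∑ k ∈ freqBall (N j), ‖coeffExt (freqBall (N j))
      (galerkinCoeffFlow ν (fourierRestrict (freqBall (N j)) f) t (c j)) k‖ ^ 2 ≤ R ^ 2)
    (hmem : ∀ j, orbitPath ν (fourierRestrict (freqBall (N j)) f) (c j) ∈ pathSpace R (pathLip ν A R))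
    (j n : ℕ) :
    ∫ t in (0 : ℝ)..n, pathDiss ν Kc (orbitPath ν (fourierRestrict (freqBall (N j)) f) (c j)) t ≤
      R ^ 2 / 2 + ∫ τ in (0 : ℝ)..n, ∫ x, ⟪f x, galerkinFlow ν f (N j) τ
        (realTrigPoly (freqBall (N j)) (coeffExt (freqBall (N j)) (c j))) x⟫_ℝ := by
  have hS : ∀ j, ∀ k ∈ freqBall (d := Fin 3) (N j), -k ∈ freqBall (d := Fin 3) (N j) := fun j =>
    neg_mem_freqBall_of_mem
  have hg : ∀ j, IsRealCoeff (fourierRestrict (freqBall (N j)) f) := fun j =>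
    isRealCoeff_mFourierCoeff hf.integrable
  have hR : ∀ j, ∑ k ∈ freqBall (N j), ‖coeffExt (freqBall (N j)) (c j) k‖ ^ 2 ≤ R ^ 2 := fun j => by
    simpa only [galerkinCoeffFlow_zero] using hconf j 0 le_rfl
  obtain ⟨U, hU⟩ : ∃ U : ℕ → ℝ → UnitAddTorus (Fin 3) → EuclideanSpace ℝ (Fin 3),
      U = fun j t => galerkinFlow ν f (N j) t
        (realTrigPoly (freqBall (N j)) (coeffExt (freqBall (N j)) (c j))) := ⟨_, rfl⟩
  have hUjt : ∀ j t, U j t = galerkinFlow ν f (N j) t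
      (realTrigPoly (freqBall (N j)) (coeffExt (freqBall (N j)) (c j))) := fun j t => by rw [hU]
  have hF : IsHopfGalerkinFamily ν (fun _ => f) (fun _ => EuclideanSpace.single (0 : Fin 3) R) N
      (fun _ _ => f) U := by
    rw [hU]; exact isHopfGalerkinFamily_galerkinFlow hν.le hf hN hc hR
  have hn0 : (0 : ℝ) ≤ n := Nat.cast_nonneg n
  simp_rw [← hUjt]
  -- the energy identity on `[0, n]`
  have hE := hF.energy_eq j 0 n le_rfl hn0
  have hkin0 : kineticEnergy (U j 0) ≤ R ^ 2 / 2 := by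
    rw [kineticEnergy, hUjt, galerkinFlow_zero, integral_norm_sq_realTrigPoly_coeffExt (hc j)]
    linarith [hR j]
  have hkinn : 0 ≤ kineticEnergy (U j n) := by
    rw [kineticEnergy]; exact mul_nonneg (by norm_num) (integral_nonneg fun x => sq_nonneg _)
  have hD : ν * (∫⁻ τ in Ioo (0 : ℝ) n, eGradNormSq (U j τ)).toReal ≤
      R ^ 2 / 2 + ∫ τ in (0 : ℝ)..n, ∫ x, ⟪f x, U j τ x⟫_ℝ := by linarith
  refine le_trans ?_ hD
  -- `∫₀ⁿ pathDiss ≤ ν ∫₀ⁿ ‖∇U_j‖²`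
  have hfin : ∫⁻ τ in Ioo (0 : ℝ) n, eGradNormSq (U j τ) ≠ ⊤ := (hF.lintegral_eGradNormSq_lt_top j n).ne
  have hpt : ∀ τ, 0 ≤ τ → ENNReal.ofReal (pathDiss ν Kc (orbitPath ν (fourierRestrict (freqBall (N j)) f) (c j)) τ) ≤
      ENNReal.ofReal ν * eGradNormSq (U j τ) := by
    intro τ hτ
    have hcoef : ∀ k, mFourierCoeff (EuclideanSpace.complexify ∘ U j τ) k =
        pathExt (orbitPath ν (fourierRestrict (freqBall (N j)) f) (c j)) τ k := fun k => by
      rw [hUjt, mFourierCoeff_galerkinFlow_realTrigPoly (hc j),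
        pathExt_orbitPath hν.le (hS j) (hg j) (hc j) (hmem j) hτ k]
    have hfinτ : eGradNormSq (U j τ) ≠ ⊤ := by
      rw [hUjt]; exact eGradNormSq_galerkinFlow_realTrigPoly_ne_top (hc j) τ
    have h := pathDiss_le_mul_toReal_eGradNormSq hν.le Kc hcoef hfinτ
    calc ENNReal.ofReal (pathDiss ν Kc (orbitPath ν (fourierRestrict (freqBall (N j)) f) (c j)) τ)
        ≤ ENNReal.ofReal (ν * (eGradNormSq (U j τ)).toReal) := ENNReal.ofReal_le_ofReal h
      _ = ENNReal.ofReal ν * eGradNormSq (U j τ) := by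
          rw [ENNReal.ofReal_mul hν.le, ENNReal.ofReal_toReal hfinτ]
  have hpd_nonneg : ∀ t, 0 ≤ pathDiss ν Kc (orbitPath ν (fourierRestrict (freqBall (N j)) f) (c j)) t :=
    fun t => pathDiss_nonneg hν.le Kc _ t
  have hpd_meas : AEStronglyMeasurable
      (fun t => pathDiss ν Kc (orbitPath ν (fourierRestrict (freqBall (N j)) f) (c j)) t)
      (volume.restrict (Ioo (0 : ℝ) n)) :=
    (intervalIntegrable_pathDiss (hmem j) ν Kc 0 n).1.aestronglyMeasurable.mono_measure
      (Measure.restrict_mono Ioo_subset_Ioc_self le_rfl)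
  have hlhs : ∫ t in (0 : ℝ)..n, pathDiss ν Kc (orbitPath ν (fourierRestrict (freqBall (N j)) f) (c j)) t =
      (∫⁻ t in Ioo (0 : ℝ) n, ENNReal.ofReal
        (pathDiss ν Kc (orbitPath ν (fourierRestrict (freqBall (N j)) f) (c j)) t)).toReal := by
    rw [intervalIntegral.integral_of_le hn0, integral_Ioc_eq_integral_Ioo,
      integral_eq_lintegral_of_nonneg_ae (ae_of_all _ fun t => hpd_nonneg t) hpd_meas]
  rw [hlhs]
  have hfin' : ENNReal.ofReal ν * ∫⁻ τ in Ioo (0 : ℝ) n, eGradNormSq (U j τ) ≠ ⊤ :=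
    ENNReal.mul_ne_top ENNReal.ofReal_ne_top hfin
  have hmono : ∫⁻ t in Ioo (0 : ℝ) n, ENNReal.ofReal
      (pathDiss ν Kc (orbitPath ν (fourierRestrict (freqBall (N j)) f) (c j)) t) ≤
      ENNReal.ofReal ν * ∫⁻ τ in Ioo (0 : ℝ) n, eGradNormSq (U j τ) := by
    rw [← lintegral_const_mul' _ _ ENNReal.ofReal_ne_top]
    exact setLIntegral_mono' measurableSet_Ioo fun τ hτ => hpt τ hτ.1.le
  calc (∫⁻ t in Ioo (0 : ℝ) n, ENNReal.ofReal
        (pathDiss ν Kc (orbitPath ν (fourierRestrict (freqBall (N j)) f) (c j)) t)).toReal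
      ≤ (ENNReal.ofReal ν * ∫⁻ τ in Ioo (0 : ℝ) n, eGradNormSq (U j τ)).toReal :=
        ENNReal.toReal_mono hfin' hmono
    _ = ν * (∫⁻ τ in Ioo (0 : ℝ) n, eGradNormSq (U j τ)).toReal := by
        rw [ENNReal.toReal_mul, ENNReal.toReal_ofReal hν.le]

/-! ### Passing to the limit -/

/-- **The coupling inequality in the limit.**  If the orbit paths of confined Galerkin orbits of
orders `N j → ∞` converge (at every `t ≥ 0` and every frequency) to the path `ω ∈ 𝒦`, then for
every integer window `∫₀ⁿ pathDiss ν K ω ≤ R²/2 + ‖f‖₂ √n (∫₀ⁿ pathEnergyTot ω)^{1/2}`. -/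
theorem intervalIntegral_pathDiss_le_of_tendsto (hν : 0 < ν) (hf : IsSmooth f) {R A : ℝ} (Kc : ℕ)
    {N : ℕ → ℕ} (hN : Tendsto N atTop atTop)
    {c : (j : ℕ) → ↥(freqBall (d := Fin 3) (N j)) → EuclideanSpace ℂ (Fin 3)}
    (hc : ∀ j, c j ∈ galerkinSubspace (freqBall (N j)))
    (hconf : ∀ j t, 0 ≤ t → ∑ k ∈ freqBall (N j), ‖coeffExt (freqBall (N j))
      (galerkinCoeffFlow ν (fourierRestrict (freqBall (N j)) f) t (c j)) k‖ ^ 2 ≤ R ^ 2)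
    (hmem : ∀ j, orbitPath ν (fourierRestrict (freqBall (N j)) f) (c j) ∈ pathSpace R (pathLip ν A R))
    {ω : Path (Fin 3)} (hω : ω ∈ pathSpace R (pathLip ν A R))
    (hlim : ∀ t, 0 ≤ t → ∀ k, Tendsto
      (fun j => pathExt (orbitPath ν (fourierRestrict (freqBall (N j)) f) (c j)) t k) atTop
      (𝓝 (pathExt ω t k)))
    (n : ℕ) :
    ∫ t in (0 : ℝ)..n, pathDiss ν Kc ω t ≤ R ^ 2 / 2 +
      Real.sqrt (∫ x, ‖f x‖ ^ 2) * (Real.sqrt n * Real.sqrt (∫ t in (0 : ℝ)..n, pathEnergyTot ω t)) := by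
  have hS : ∀ j, ∀ k ∈ freqBall (d := Fin 3) (N j), -k ∈ freqBall (d := Fin 3) (N j) := fun j =>
    neg_mem_freqBall_of_mem
  have hg : ∀ j, IsRealCoeff (fourierRestrict (freqBall (N j)) f) := fun j =>
    isRealCoeff_mFourierCoeff hf.integrable
  have hR : ∀ j, ∑ k ∈ freqBall (N j), ‖coeffExt (freqBall (N j)) (c j) k‖ ^ 2 ≤ R ^ 2 := fun j => by
    simpa only [galerkinCoeffFlow_zero] using hconf j 0 le_rfl
  obtain ⟨U, hU⟩ : ∃ U : ℕ → ℝ → UnitAddTorus (Fin 3) → EuclideanSpace ℝ (Fin 3),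
      U = fun j t => galerkinFlow ν f (N j) t
        (realTrigPoly (freqBall (N j)) (coeffExt (freqBall (N j)) (c j))) := ⟨_, rfl⟩
  have hUjt : ∀ j t, U j t = galerkinFlow ν f (N j) t
      (realTrigPoly (freqBall (N j)) (coeffExt (freqBall (N j)) (c j))) := fun j t => by rw [hU]
  have hF : IsHopfGalerkinFamily ν (fun _ => f) (fun _ => EuclideanSpace.single (0 : Fin 3) R) N
      (fun _ _ => f) U := by
    rw [hU]; exact isHopfGalerkinFamily_galerkinFlow hν.le hf hN hc hR
  have hn0 : (0 : ℝ) ≤ n := Nat.cast_nonneg n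
  set L : (Fin 3 → ℤ) → ℝ := pathLip ν A R with hL
  set A' := Real.sqrt (∫ x, ‖f x‖ ^ 2) with hA'
  have hA'0 : 0 ≤ A' := Real.sqrt_nonneg _
  -- the limit field of `ω`
  obtain ⟨u, -, hu⟩ := exists_pathField hω 0
  simp only [zero_add] at hu
  have hu2 : ∀ t, 0 ≤ t → MemLp (u t) 2 volume := fun t ht => (hu t ht).1
  have hu₀ : MemLp (fun _ : UnitAddTorus (Fin 3) => EuclideanSpace.single (0 : Fin 3) R) 2 volume :=
    memLp_const _
  have hfm := aestronglyMeasurable_stLift_const hf (volume.restrict (Ioi (0 : ℝ) ×ˢ univ))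
  have hf₂ : ∀ T : ℝ, 0 < T → ∫⁻ _ in Ioo (0 : ℝ) T, ∫⁻ x, ‖f x‖ₑ ^ 2 < ⊤ := fun T _ =>
    lintegral_force_lt_top hf T
  -- coefficients of the orbits and their convergence
  have hcoefU : ∀ j t, 0 ≤ t → ∀ k, mFourierCoeff (EuclideanSpace.complexify ∘ U j t) k =
      pathExt (orbitPath ν (fourierRestrict (freqBall (N j)) f) (c j)) t k := fun j t ht k => by
    rw [hUjt, mFourierCoeff_galerkinFlow_realTrigPoly (hc j),
      pathExt_orbitPath hν.le (hS j) (hg j) (hc j) (hmem j) ht k]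
  have hcv : ∀ t, 0 ≤ t → ∀ k, Tendsto (fun j => mFourierCoeff (EuclideanSpace.complexify ∘ U j t) k)
      atTop (𝓝 (mFourierCoeff (EuclideanSpace.complexify ∘ u t) k)) := by
    intro t ht k
    rw [(hu t ht).2 k]
    exact (hlim t ht k).congr fun j => (hcoefU j t ht k).symm
  -- (i) the resolved dissipations converge (dominated convergence on `[0, n]`)
  have hDlim : Tendsto (fun j => ∫ t in (0 : ℝ)..n,
      pathDiss ν Kc (orbitPath ν (fourierRestrict (freqBall (N j)) f) (c j)) t) atTop
      (𝓝 (∫ t in (0 : ℝ)..n, pathDiss ν Kc ω t)) := by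
    refine intervalIntegral.tendsto_integral_filter_of_dominated_convergence
      (fun _ => ν * (4 * Real.pi ^ 2 * ((Kc : ℝ) ^ 2 * R ^ 2))) ?_ ?_ intervalIntegrable_const ?_
    · refine Eventually.of_forall fun j => ?_
      exact (intervalIntegrable_pathDiss (hmem j) ν Kc 0 n).1.aestronglyMeasurable.mono_measure
        (Measure.restrict_mono (by rw [uIoc_of_le hn0]) le_rfl)
    · refine Eventually.of_forall fun j => ae_of_all _ fun t _ => ?_
      rw [Real.norm_eq_abs, abs_of_nonneg (pathDiss_nonneg hν.le Kc _ t)]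
      exact pathDiss_le hν.le Kc (hmem j) t
    · refine ae_of_all _ fun t ht => ?_
      have ht0 : 0 ≤ t := by rw [uIoc_of_le hn0] at ht; exact ht.1.le
      unfold pathDiss
      exact tendsto_const_nhds.mul (tendsto_const_nhds.mul (tendsto_finsetSum _ fun k _ =>
        tendsto_const_nhds.mul (((hlim t ht0 k).norm).pow 2)))
  -- (ii) the powers converge (dominated convergence on `[0, n]`)
  have hPmeas : ∀ j, AEStronglyMeasurable (fun τ => ∫ x, ⟪f x, U j τ x⟫_ℝ)
      (volume.restrict (Ι (0 : ℝ) n)) := by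
    intro j
    have hcont : ContinuousOn (fun τ => ∫ x, ⟪f x, U j τ x⟫_ℝ) (Ici 0) :=
      continuousOn_integral_inner_of_continuousOn_stLift (u := fun _ => f)
        (contDiff_stLift_const hf).continuous.continuousOn (hF.continuousOn j)
    rw [uIoc_of_le hn0]
    exact (hcont.mono fun t ht => ht.1.le).aestronglyMeasurable measurableSet_Ioc
  have hPbound : ∀ j τ, 0 ≤ τ → |∫ x, ⟪f x, U j τ x⟫_ℝ| ≤ A' * |R| := by
    intro j τ hτ
    have hmode := hF.isGalerkinMode j τ hτ
    refine (abs_integral_inner_le_sqrt_mul_sqrt (hf.memLp 2) (hmode.isSmooth.memLp 2)).trans ?_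
    refine mul_le_mul_of_nonneg_left ?_ hA'0
    rw [hUjt, integral_norm_sq_galerkinFlow_realTrigPoly (hc j), ← Real.sqrt_sq_eq_abs]
    exact Real.sqrt_le_sqrt (hconf j τ hτ)
  have hPlim : ∀ τ, 0 ≤ τ → Tendsto (fun j => ∫ x, ⟪f x, U j τ x⟫_ℝ) atTop
      (𝓝 (∫ x, ⟪f x, u τ x⟫_ℝ)) := by
    intro τ hτ
    have h := hF.tendsto_integral_inner_limit hν.le hu₀ hfm hf₂ hu2 hcv (hf.memLp 2) hτ
    simp_rw [real_inner_comm (f _)] at h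
    exact h
  have hWlim : Tendsto (fun j => ∫ τ in (0 : ℝ)..n, ∫ x, ⟪f x, U j τ x⟫_ℝ) atTop
      (𝓝 (∫ τ in (0 : ℝ)..n, ∫ x, ⟪f x, u τ x⟫_ℝ)) := by
    refine intervalIntegral.tendsto_integral_filter_of_dominated_convergence (fun _ => A' * |R|)
      (Eventually.of_forall hPmeas) ?_ intervalIntegrable_const ?_
    · refine Eventually.of_forall fun j => ae_of_all _ fun τ hτ => ?_
      have hτ0 : 0 ≤ τ := by rw [uIoc_of_le hn0] at hτ; exact hτ.1.le
      rw [Real.norm_eq_abs]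
      exact hPbound j τ hτ0
    · refine ae_of_all _ fun τ hτ => ?_
      have hτ0 : 0 ≤ τ := by rw [uIoc_of_le hn0] at hτ; exact hτ.1.le
      exact hPlim τ hτ0
  -- (iii) the level-`j` inequality passes to the limit
  have hle : ∫ t in (0 : ℝ)..n, pathDiss ν Kc ω t ≤
      R ^ 2 / 2 + ∫ τ in (0 : ℝ)..n, ∫ x, ⟪f x, u τ x⟫_ℝ := by
    refine le_of_tendsto_of_tendsto' hDlim (tendsto_const_nhds.add hWlim) fun j => ?_
    have h := intervalIntegral_pathDiss_orbit_le hν hf Kc hN hc hconf hmem j n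
    simp_rw [← hUjt] at h
    exact h
  -- (iv) the limit power is at most `‖f‖₂ √(pathEnergyTot ω)`
  have hPinf_meas : AEStronglyMeasurable (fun τ => ∫ x, ⟪f x, u τ x⟫_ℝ)
      (volume.restrict (Ι (0 : ℝ) n)) := by
    refine aestronglyMeasurable_of_tendsto_ae atTop (fun j => hPmeas j) ?_
    filter_upwards [ae_restrict_mem measurableSet_uIoc] with τ hτ
    have hτ0 : 0 ≤ τ := by rw [uIoc_of_le hn0] at hτ; exact hτ.1.le
    exact hPlim τ hτ0
  have hPinf_int : IntervalIntegrable (fun τ => ∫ x, ⟪f x, u τ x⟫_ℝ) volume 0 n := by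
    refine (intervalIntegrable_const (c := A' * |R|)).mono_fun hPinf_meas ?_
    filter_upwards [ae_restrict_mem measurableSet_uIoc] with τ hτ
    have hτ0 : 0 ≤ τ := by rw [uIoc_of_le hn0] at hτ; exact hτ.1.le
    rw [Real.norm_eq_abs, Real.norm_eq_abs, abs_of_nonneg (mul_nonneg hA'0 (abs_nonneg R))]
    exact le_of_tendsto' ((hPlim τ hτ0).abs) fun j => hPbound j τ hτ0
  have hsqrt_meas : Measurable fun τ => Real.sqrt (pathEnergyTot ω τ) :=
    (measurable_pathEnergyTot_time hω).sqrt
  have hsqrt_bound : ∀ τ, Real.sqrt (pathEnergyTot ω τ) ≤ |R| := fun τ => by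
    rw [← Real.sqrt_sq_eq_abs]; exact Real.sqrt_le_sqrt (pathEnergyTot_le hω τ)
  have hsqrt_int : IntervalIntegrable (fun τ => Real.sqrt (pathEnergyTot ω τ)) volume 0 n := by
    refine (intervalIntegrable_const (c := |R|)).mono_fun hsqrt_meas.aestronglyMeasurable ?_
    refine ae_of_all _ fun τ => ?_
    simp only [Real.norm_eq_abs, abs_of_nonneg (Real.sqrt_nonneg _), abs_abs]
    exact hsqrt_bound τ
  have hPinf_le : ∫ τ in (0 : ℝ)..n, ∫ x, ⟪f x, u τ x⟫_ℝ ≤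
      ∫ τ in (0 : ℝ)..n, A' * Real.sqrt (pathEnergyTot ω τ) := by
    refine intervalIntegral.integral_mono_on hn0 hPinf_int (hsqrt_int.const_mul A') fun τ hτ => ?_
    exact (le_abs_self _).trans (abs_integral_inner_le_of_coef (hu τ hτ.1).1 (hu τ hτ.1).2 (hf.memLp 2))
  rw [intervalIntegral.integral_const_mul] at hPinf_le
  -- (v) Cauchy–Schwarz in time
  have hCS := integral_sqrt_le hn0 (fun t => pathEnergyTot_nonneg ω t)
    (intervalIntegrable_pathEnergyTot hω 0 n) hsqrt_int
  calc ∫ t in (0 : ℝ)..n, pathDiss ν Kc ω t ≤ R ^ 2 / 2 + ∫ τ in (0 : ℝ)..n, ∫ x, ⟪f x, u τ x⟫_ℝ := hle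
    _ ≤ R ^ 2 / 2 + A' * ∫ τ in (0 : ℝ)..n, Real.sqrt (pathEnergyTot ω τ) := by linarith
    _ ≤ R ^ 2 / 2 + A' * (Real.sqrt n * Real.sqrt (∫ t in (0 : ℝ)..n, pathEnergyTot ω t)) := by
        gcongr

/-- **The coupling in Birkhoff form** (hypothesis `hcouple` of `exists_mem_support_birkhoff_limits`):
under the hypotheses of `intervalIntegral_pathDiss_le_of_tendsto`, for every `n ≥ 1`,
`A_n F_d(ω) ≤ (R²/2)/n + ‖f‖₂ (A_n F_e(ω))^{1/2}` along the unit shift on `𝒦`. -/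
theorem birkhoffAverage_dissMean_le_of_tendsto (hν : 0 < ν) (hf : IsSmooth f) {R A : ℝ} (Kc : ℕ)
    {N : ℕ → ℕ} (hN : Tendsto N atTop atTop)
    {c : (j : ℕ) → ↥(freqBall (d := Fin 3) (N j)) → EuclideanSpace ℂ (Fin 3)}
    (hc : ∀ j, c j ∈ galerkinSubspace (freqBall (N j)))
    (hconf : ∀ j t, 0 ≤ t → ∑ k ∈ freqBall (N j), ‖coeffExt (freqBall (N j))
      (galerkinCoeffFlow ν (fourierRestrict (freqBall (N j)) f) t (c j)) k‖ ^ 2 ≤ R ^ 2)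
    (hmem : ∀ j, orbitPath ν (fourierRestrict (freqBall (N j)) f) (c j) ∈ pathSpace R (pathLip ν A R))
    {ω : Path (Fin 3)} (hω : ω ∈ pathSpace R (pathLip ν A R))
    (hlim : ∀ t, 0 ≤ t → ∀ k, Tendsto
      (fun j => pathExt (orbitPath ν (fourierRestrict (freqBall (N j)) f) (c j)) t k) atTop
      (𝓝 (pathExt ω t k)))
    {n : ℕ} (hn : 0 < n) :
    birkhoffAverage ℝ (pathShiftOn R (pathLip ν A R) (pathShift_mapsTo R (pathLip ν A R)))
        (fun x => dissMean ν Kc x.1) n ⟨ω, hω⟩ ≤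
      (R ^ 2 / 2) / n + Real.sqrt (∫ x, ‖f x‖ ^ 2) *
        Real.sqrt (birkhoffAverage ℝ (pathShiftOn R (pathLip ν A R) (pathShift_mapsTo R (pathLip ν A R)))
          (fun x => energyMean x.1) n ⟨ω, hω⟩) := by
  have h := intervalIntegral_pathDiss_le_of_tendsto hν hf Kc hN hc hconf hmem hω hlim n
  rw [birkhoffAverage, birkhoffAverage, birkhoffSum_dissMean, birkhoffSum_energyMean]
  simp only [smul_eq_mul]
  have hnpos : (0 : ℝ) < n := by exact_mod_cast hn
  set I := ∫ t in (0 : ℝ)..n, pathEnergyTot ω t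
  set J := ∫ t in (0 : ℝ)..n, pathDiss ν Kc ω t
  set A' := Real.sqrt (∫ x, ‖f x‖ ^ 2)
  have e : (n : ℝ)⁻¹ * (Real.sqrt n * Real.sqrt I) = Real.sqrt ((n : ℝ)⁻¹ * I) := by
    rw [← mul_assoc, inv_mul_eq_div, Real.sqrt_div_self, Real.sqrt_mul (inv_nonneg.2 hnpos.le),
      Real.sqrt_inv]
  calc (n : ℝ)⁻¹ * J ≤ (n : ℝ)⁻¹ * (R ^ 2 / 2 + A' * (Real.sqrt n * Real.sqrt I)) :=
        mul_le_mul_of_nonneg_left h (inv_nonneg.2 hnpos.le)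
    _ = R ^ 2 / 2 / n + A' * ((n : ℝ)⁻¹ * (Real.sqrt n * Real.sqrt I)) := by ring
    _ = R ^ 2 / 2 / n + A' * Real.sqrt ((n : ℝ)⁻¹ * I) := by rw [e]

end Summit.AnomalousDissipation.AnomalousDissipation.Theorems.MomentParity
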